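import Literature.Analysis.FluidPDE.SereginSverakProbeEnergyNoJump
import Literature.Analysis.FluidPDE.SereginSverakTypeIConsequences
import Literature.Analysis.FluidPDE.SpaceTimeRescaling
import Literature.Analysis.FunctionSpaces.SpaceTimeWeakCompactness
import HarnessLib

/-!
# One-sided pressure bounds: largeness and Type I of the zooms, integrated in time, and their
# passage to the blow-up limit

Analysis/FluidPDE proof file (theorems only; no definitions, no named facts) on the discharge
path of the named fact `Literature.Analysis.FluidPDE.seregin_sverak_2002`
(`SereginSverakPressure.lean`; G. Seregin, V. Šverák, Arch. Ration. Mech. Anal. **163** (2002)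
65–86). Let `u` be a classical Leray–Hopf solution on `[0, T)` (`ν = 1`) with a one-sided
pressure bound, `x₀` a centre, and `v^c(s, y) = c u(T + c² s, x₀ + c y)` the parabolic zoom at
the vertex `(T, x₀)` (`c • stPull (c²) c T x₀ u`).

* `integral_norm_sq_zoom_mul`, `probeEnergy_zoom`, `setIntegral_ball_norm_sq_stZoom` — change of
  variables: `∫ |v^c(s)|² φ = c⁻¹ ∫ |u(T + c²s)|² φ(c⁻¹(· − x₀))`; the probe energy is scale
  covariant, `F_{v^c}(r; z, s) = F_u(cr; x₀ + cz, T + c²s)`, and so are the ball energies.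
* `setIntegral_ball_probe_zoom_ge` — **largeness at the unit scale, truncated to a ball**: if
  `F_u(r; x₀, t) ≥ δ/2` for `t ∈ (T − θ²r², T)`, `r ≤ r₀` (the conclusion of
  `probeEnergy_ge_on_final_windows`), then for `c ≤ r₀`, `a ≥ 1`, `ac ≤ 1`, `s ∈ (−θ², 0)`:
  `∫_{B_a} |v^c(s)|² P̄(|y|²) ≥ δ/2 − M_F/a²`, `M_F = ‖u(0)‖₂² + 4πK` — the tail beyond `B_a` is
  *exactly* `a⁻² ∫_{|y| ≥ a} |v^c|² a⁻¹P̄(|y|²/a²) ≤ a⁻² F_{v^c}(a) ≤ M_F/a²` by the power law of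
  the probe.
* `setIntegral_ball_zoom_le` — **Type I of the zooms**: `∫_{B_ρ(z)} |v^c(s)|² ≤ 2 M_F ρ`
  (`cρ ≤ 1/2`).
* `setIntegral_window_probe_zoom_ge`, `setIntegral_window_ball_zoom_le` — the same two bounds
  integrated over a time window `(s₁, s₂)`, `s₂ < 0` (Fubini).
* `le_setIntegral_norm_sq_mul_of_tendsto`, `setIntegral_norm_sq_le_of_tendsto` — lower/upper
  bounds on weighted `L²` masses pass to `L²` limits (Minkowski in `L²`);
* `blowupLimit_window_probe_ge`, `blowupLimit_window_ball_le` — hence the blow-up limit `w` of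
  `SereginSverakBlowupExtraction.lean` inherits, **in time-integrated form**, the largeness
  `∫_{(s₁,s₂)×B_a} |w|² P̄(|y|²) ≥ (s₂ − s₁)(δ/2 − M_F/a²)` and the Type I bound
  `∫_{(s₁,s₂)×B_ρ(z)} |w|² ≤ 2 M_F ρ (s₂ − s₁)`.

## References

* G. Seregin, V. Šverák, Arch. Ration. Mech. Anal. 163 (2002), 65–86 (the result served).
  [SereginSverak2002]
-/

noncomputable section

open _root_.MeasureTheory Set Function Filter _root_.Topology TopologicalSpace Metric Real
open scoped NNReal ENNReal RealInnerProductSpace ContDiff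

namespace Literature.Analysis.FluidPDE

namespace SereginSverak2002

variable {P Pb : ℝ → ℝ}

/-! ### Change of variables for the zooms -/

/-- **Zoom and weighted energies**: for `c > 0`,
`∫ |c u(t₀ + c²s, x₀ + c y)|² φ(y) dy = c⁻¹ ∫ |u(t₀ + c²s, x)|² φ(c⁻¹(x − x₀)) dx`. [folklore] -/
theorem integral_norm_sq_zoom_mul {c : ℝ} (hc : 0 < c) (t₀ s : ℝ) (x₀ : EuclideanSpace ℝ (Fin 3))
    (u : ℝ → EuclideanSpace ℝ (Fin 3) → EuclideanSpace ℝ (Fin 3))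
    (φ : EuclideanSpace ℝ (Fin 3) → ℝ) :
    ∫ y, ‖(c • stPull (c ^ 2) c t₀ x₀ u) s y‖ ^ 2 * φ y =
      c⁻¹ * ∫ x, ‖u (t₀ + c ^ 2 * s) x‖ ^ 2 * φ (c⁻¹ • (x - x₀)) := by
  set g : EuclideanSpace ℝ (Fin 3) → ℝ :=
    fun x => ‖u (t₀ + c ^ 2 * s) x‖ ^ 2 * φ (c⁻¹ • (x - x₀)) with hg
  have hpt : ∀ y, ‖(c • stPull (c ^ 2) c t₀ x₀ u) s y‖ ^ 2 * φ y = c ^ 2 * g (x₀ + c • y) := by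
    intro y
    have h1 : (c • stPull (c ^ 2) c t₀ x₀ u) s y = c • u (t₀ + c ^ 2 * s) (x₀ + c • y) := rfl
    rw [h1, hg, norm_smul, mul_pow, Real.norm_eq_abs, sq_abs]
    simp only [add_sub_cancel_left, inv_smul_smul₀ hc.ne']
    ring
  simp_rw [hpt]
  rw [integral_const_mul]
  have h2 : ∫ y, g (x₀ + c • y) = |(c ^ 3)⁻¹| * ∫ x, g x := by
    have := Measure.integral_comp_smul volume (fun w => g (x₀ + w)) c
    simp only [finrank_euclideanSpace_fin, smul_eq_mul] at this
    rw [this, integral_add_left_eq_self g x₀]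
  rw [h2, abs_of_pos (by positivity), ← mul_assoc]
  congr 1
  field_simp

/-- **Scale covariance of the probe energy**:
`F_{v^c}(r; z, s) = F_u(cr; x₀ + cz, t₀ + c²s)`. [folklore] -/
theorem probeEnergy_zoom {c r : ℝ} (hc : 0 < c) (hr : 0 < r) (t₀ s : ℝ)
    (x₀ z : EuclideanSpace ℝ (Fin 3))
    (u : ℝ → EuclideanSpace ℝ (Fin 3) → EuclideanSpace ℝ (Fin 3)) :
    ∫ y, ‖(c • stPull (c ^ 2) c t₀ x₀ u) s y‖ ^ 2 * (r⁻¹ * Pb (‖y - z‖ ^ 2 / r ^ 2)) =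
      ∫ x, ‖u (t₀ + c ^ 2 * s) x‖ ^ 2 *
        ((c * r)⁻¹ * Pb (‖x - (x₀ + c • z)‖ ^ 2 / (c * r) ^ 2)) := by
  rw [integral_norm_sq_zoom_mul hc, ← integral_const_mul]
  refine integral_congr_ae (Eventually.of_forall fun x => ?_)
  have h1 : ‖c⁻¹ • (x - x₀) - z‖ = c⁻¹ * ‖x - (x₀ + c • z)‖ := by
    have : c⁻¹ • (x - x₀) - z = c⁻¹ • (x - (x₀ + c • z)) := by
      rw [smul_sub, smul_sub, smul_add, inv_smul_smul₀ hc.ne']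
      abel
    rw [this, norm_smul, Real.norm_eq_abs, abs_of_pos (inv_pos.2 hc)]
  show c⁻¹ * (‖u (t₀ + c ^ 2 * s) x‖ ^ 2 * (r⁻¹ * Pb (‖c⁻¹ • (x - x₀) - z‖ ^ 2 / r ^ 2))) = _
  rw [h1]
  have h2 : (c⁻¹ * ‖x - (x₀ + c • z)‖) ^ 2 / r ^ 2 = ‖x - (x₀ + c • z)‖ ^ 2 / (c * r) ^ 2 := by
    field_simp
  rw [h2, mul_inv]
  ring

/-- The same at the centre `z = 0` and the scale `r`, with the weight written `P̄(|y|²/r²)`. [folklore] -/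
theorem probeEnergy_zoom_zero {c r : ℝ} (hc : 0 < c) (hr : 0 < r) (t₀ s : ℝ)
    (x₀ : EuclideanSpace ℝ (Fin 3))
    (u : ℝ → EuclideanSpace ℝ (Fin 3) → EuclideanSpace ℝ (Fin 3)) :
    ∫ y, ‖(c • stPull (c ^ 2) c t₀ x₀ u) s y‖ ^ 2 * (r⁻¹ * Pb (‖y‖ ^ 2 / r ^ 2)) =
      ∫ x, ‖u (t₀ + c ^ 2 * s) x‖ ^ 2 * ((c * r)⁻¹ * Pb (‖x - x₀‖ ^ 2 / (c * r) ^ 2)) := by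
  have h := probeEnergy_zoom (Pb := Pb) hc hr t₀ s x₀ 0 u
  simpa only [sub_zero, smul_zero, add_zero] using h

/-- **Scale covariance of the ball energies**:
`∫_{B_ρ(z)} |v^c(s)|² = c⁻¹ ∫_{B_{cρ}(x₀ + cz)} |u(t₀ + c²s)|²`. [folklore] -/
theorem setIntegral_ball_norm_sq_stZoom {c : ℝ} (hc : 0 < c) (t₀ s : ℝ)
    (x₀ z : EuclideanSpace ℝ (Fin 3)) (ρ : ℝ)
    (u : ℝ → EuclideanSpace ℝ (Fin 3) → EuclideanSpace ℝ (Fin 3)) :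
    ∫ y in ball z ρ, ‖(c • stPull (c ^ 2) c t₀ x₀ u) s y‖ ^ 2 =
      c⁻¹ * ∫ x in ball (x₀ + c • z) (c * ρ), ‖u (t₀ + c ^ 2 * s) x‖ ^ 2 := by
  have h := integral_norm_sq_zoom_mul hc t₀ s x₀ u ((ball z ρ).indicator fun _ => (1 : ℝ))
  have hind : ∀ x : EuclideanSpace ℝ (Fin 3),
      (ball z ρ).indicator (fun _ => (1 : ℝ)) (c⁻¹ • (x - x₀)) =
        (ball (x₀ + c • z) (c * ρ)).indicator (fun _ => (1 : ℝ)) x := by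
    intro x
    have hmem : c⁻¹ • (x - x₀) ∈ ball z ρ ↔ x ∈ ball (x₀ + c • z) (c * ρ) := by
      rw [mem_ball, mem_ball, dist_eq_norm, dist_eq_norm]
      have : c⁻¹ • (x - x₀) - z = c⁻¹ • (x - (x₀ + c • z)) := by
        rw [smul_sub, smul_sub, smul_add, inv_smul_smul₀ hc.ne']
        abel
      rw [this, norm_smul, Real.norm_eq_abs, abs_of_pos (inv_pos.2 hc), inv_mul_lt_iff₀ hc]
    by_cases hx : x ∈ ball (x₀ + c • z) (c * ρ)
    · rw [indicator_of_mem hx, indicator_of_mem (hmem.2 hx)]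
    · rw [indicator_of_notMem hx, indicator_of_notMem (fun h' => hx (hmem.1 h'))]
  simp_rw [hind] at h
  rw [← integral_indicator measurableSet_ball, ← integral_indicator measurableSet_ball]
  have e1 : (fun y => (ball z ρ).indicator
      (fun y => ‖(c • stPull (c ^ 2) c t₀ x₀ u) s y‖ ^ 2) y) =
      fun y => ‖(c • stPull (c ^ 2) c t₀ x₀ u) s y‖ ^ 2 * (ball z ρ).indicator (fun _ => (1 : ℝ)) y := by
    funext y
    by_cases hy : y ∈ ball z ρ
    · rw [indicator_of_mem hy, indicator_of_mem hy, mul_one]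
    · rw [indicator_of_notMem hy, indicator_of_notMem hy, mul_zero]
  have e2 : (fun x => (ball (x₀ + c • z) (c * ρ)).indicator
      (fun x => ‖u (t₀ + c ^ 2 * s) x‖ ^ 2) x) =
      fun x => ‖u (t₀ + c ^ 2 * s) x‖ ^ 2 *
        (ball (x₀ + c • z) (c * ρ)).indicator (fun _ => (1 : ℝ)) x := by
    funext x
    by_cases hx : x ∈ ball (x₀ + c • z) (c * ρ)
    · rw [indicator_of_mem hx, indicator_of_mem hx, mul_one]
    · rw [indicator_of_notMem hx, indicator_of_notMem hx, mul_zero]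
  rw [e1, e2]
  exact h

/-- The slices of the zoom of a field of finite energy have finite energy. [folklore] -/
theorem integrable_norm_sq_zoom {c : ℝ} (hc : 0 < c) {t₀ s : ℝ} (x₀ : EuclideanSpace ℝ (Fin 3))
    {u : ℝ → EuclideanSpace ℝ (Fin 3) → EuclideanSpace ℝ (Fin 3)}
    (hL2 : Integrable fun x => ‖u (t₀ + c ^ 2 * s) x‖ ^ 2) :
    Integrable fun y => ‖(c • stPull (c ^ 2) c t₀ x₀ u) s y‖ ^ 2 := by
  have h1 : Integrable fun y : EuclideanSpace ℝ (Fin 3) => ‖u (t₀ + c ^ 2 * s) (x₀ + c • y)‖ ^ 2 :=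
    (hL2.comp_add_left x₀).comp_smul hc.ne'
  refine (h1.const_mul (c ^ 2)).congr (Eventually.of_forall fun y => ?_)
  show c ^ 2 * ‖u (t₀ + c ^ 2 * s) (x₀ + c • y)‖ ^ 2 = ‖c • u (t₀ + c ^ 2 * s) (x₀ + c • y)‖ ^ 2
  rw [norm_smul, mul_pow, Real.norm_eq_abs, sq_abs]

/-! ### Largeness of the zooms at the unit scale, truncated to a ball -/

/-- **Largeness at the unit scale inside `B_a`.** Suppose `F_u(r; x₀, t) ≥ δ/2` for all
`t ∈ (T − θ²r², T)`, `0 < r ≤ r₀` (final-window largeness). Then for the zoom `v^c` at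
`(T, x₀)` with `0 < c ≤ r₀`, every `a ≥ 1` with `ac ≤ 1` and every `s ∈ (−θ², 0)` with
`T + c²s > 0`: `δ/2 − M_F/a² ≤ ∫_{B_a} |v^c(s)|² P̄(|y|²)`, `M_F = ‖u(0)‖₂² + 4πK`.
[cite: SereginSverak2002, §4; reconstruction] -/
theorem setIntegral_ball_probe_zoom_ge (hP : ContDiff ℝ ∞ P) (hPb : ContDiff ℝ ∞ Pb)
    (hode : ∀ σ, Pb σ + 2 / 3 * σ * deriv Pb σ = P σ) (hP0 : ∀ σ, 1 ≤ σ → P σ = 0)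
    (hPnn : ∀ σ, 0 ≤ P σ) (hPle : ∀ σ, P σ ≤ Pb σ) (hPble : ∀ σ, Pb σ ≤ 1)
    (hPbpos : ∀ σ, 0 < Pb σ) (hPb' : ∀ σ, deriv Pb σ ≤ 0)
    {T : ℝ} {u : ℝ → EuclideanSpace ℝ (Fin 3) → EuclideanSpace ℝ (Fin 3)}
    {p : ℝ → EuclideanSpace ℝ (Fin 3) → ℝ}
    (hsol : IsClassicalNSSolutionOn (Ico 0 T) 1 0 u p) (hLH : IsLerayHopfOn T 1 0 (u 0) u)
    {K : ℝ} (hK : 0 ≤ K)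
    (hone : (∀ t ∈ Ioo 0 T, ∀ x, ‖u t x‖ ^ 2 / 2 + normalisedPressure (u t) x ≤ K) ∨
      (∀ t ∈ Ioo 0 T, ∀ x, -K ≤ normalisedPressure (u t) x))
    (x₀ : EuclideanSpace ℝ (Fin 3)) {δ θ r₀ : ℝ}
    (hlarge : ∀ r ∈ Ioc 0 r₀, ∀ t ∈ Ioo (T - θ ^ 2 * r ^ 2) T,
      δ / 2 ≤ ∫ x, ‖u t x‖ ^ 2 * (r⁻¹ * Pb (‖x - x₀‖ ^ 2 / r ^ 2)))
    {c a s : ℝ} (hc : 0 < c) (hcr₀ : c ≤ r₀) (ha : 1 ≤ a) (hac : a * c ≤ 1)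
    (hs : s ∈ Ioo (-θ ^ 2) 0) (hsT : 0 < T + c ^ 2 * s) :
    δ / 2 - ((∫ x, ‖u 0 x‖ ^ 2) + 4 * π * K) / a ^ 2 ≤
      ∫ y in ball 0 a, ‖(c • stPull (c ^ 2) c T x₀ u) s y‖ ^ 2 * Pb (‖y‖ ^ 2) := by
  have hPbnn : ∀ σ, 0 ≤ Pb σ := fun σ => (hPbpos σ).le
  have hPbd : Differentiable ℝ Pb := hPb.differentiable (by simp)
  have ha0 : 0 < a := by linarith
  set t : ℝ := T + c ^ 2 * s with ht
  have htT : t ∈ Ioo 0 T := ⟨hsT, by rw [ht]; nlinarith [mul_neg_of_pos_of_neg (pow_pos hc 2) hs.2]⟩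
  have htI : t ∈ Icc 0 T := ⟨htT.1.le, htT.2.le⟩
  have hL2 : Integrable fun x => ‖u t x‖ ^ 2 :=
    (hLH.memLp t htI).integrable_norm_pow two_ne_zero
  set v := c • stPull (c ^ 2) c T x₀ u with hv
  have hvL2 : Integrable fun y => ‖v s y‖ ^ 2 := integrable_norm_sq_zoom hc x₀ hL2
  -- the probe energies of the zoom at the scales `1` and `a`
  have hF1 : δ / 2 ≤ ∫ y, ‖v s y‖ ^ 2 * ((1 : ℝ)⁻¹ * Pb (‖y‖ ^ 2 / 1 ^ 2)) := by
    rw [hv, probeEnergy_zoom_zero hc one_pos, mul_one]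
    refine hlarge c ⟨hc, hcr₀⟩ t ⟨?_, htT.2⟩
    rw [ht]; nlinarith [mul_lt_mul_of_pos_left hs.1 (pow_pos hc 2)]
  have hFa : ∫ y, ‖v s y‖ ^ 2 * (a⁻¹ * Pb (‖y‖ ^ 2 / a ^ 2)) ≤ (∫ x, ‖u 0 x‖ ^ 2) + 4 * π * K := by
    rw [hv, probeEnergy_zoom_zero hc ha0]
    exact probeEnergy_le_uniform hP hPb hode hP0 hPnn hPle hPble hPb' zero_le_one hsol hLH hK hone
      htT x₀ (by positivity) (by rwa [mul_comm])
  -- integrability of the two weighted energies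
  have hi1 : Integrable fun y => ‖v s y‖ ^ 2 * ((1 : ℝ)⁻¹ * Pb (‖y‖ ^ 2 / 1 ^ 2)) := by
    refine (hvL2.mul_const 1).mono' (hvL2.aestronglyMeasurable.mul ?_) (Eventually.of_forall fun y => ?_)
    · exact (continuous_const.mul (hPb.continuous.comp ((continuous_norm.pow 2).div_const _))).aestronglyMeasurable
    · rw [Real.norm_eq_abs, abs_mul, abs_of_nonneg (sq_nonneg _), abs_of_nonneg (by
        exact mul_nonneg (by norm_num) (hPbnn _))]
      exact mul_le_mul_of_nonneg_left (by rw [inv_one, one_mul]; exact hPble _) (sq_nonneg _)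
  have hia : Integrable fun y => ‖v s y‖ ^ 2 * (a⁻¹ * Pb (‖y‖ ^ 2 / a ^ 2)) := by
    refine (hvL2.mul_const a⁻¹).mono' (hvL2.aestronglyMeasurable.mul ?_) (Eventually.of_forall fun y => ?_)
    · exact (continuous_const.mul (hPb.continuous.comp ((continuous_norm.pow 2).div_const _))).aestronglyMeasurable
    · rw [Real.norm_eq_abs, abs_mul, abs_of_nonneg (sq_nonneg _), abs_of_nonneg (by
        exact mul_nonneg (inv_pos.2 ha0).le (hPbnn _))]
      exact mul_le_mul_of_nonneg_left (mul_le_of_le_one_right (inv_pos.2 ha0).le (hPble _))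
        (sq_nonneg _)
  -- split the unit-scale energy at `|y| = a`
  have hsplit := integral_add_compl (μ := volume) measurableSet_ball hi1 (s := ball (0 : EuclideanSpace ℝ (Fin 3)) a)
  -- inside: the weight is `P̄(|y|²)`
  have hin : ∫ y in ball (0 : EuclideanSpace ℝ (Fin 3)) a, ‖v s y‖ ^ 2 * ((1 : ℝ)⁻¹ * Pb (‖y‖ ^ 2 / 1 ^ 2)) =
      ∫ y in ball 0 a, ‖v s y‖ ^ 2 * Pb (‖y‖ ^ 2) := by
    refine integral_congr_ae (Eventually.of_forall fun y => ?_)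
    simp only [inv_one, one_mul, one_pow, div_one]
  -- outside: the power law `P̄(|y|²) = a⁻² · a⁻¹P̄(|y|²/a²)` and `F_{v}(a) ≤ M_F`
  have hout : ∫ y in (ball (0 : EuclideanSpace ℝ (Fin 3)) a)ᶜ, ‖v s y‖ ^ 2 * ((1 : ℝ)⁻¹ * Pb (‖y‖ ^ 2 / 1 ^ 2)) ≤
      ((∫ x, ‖u 0 x‖ ^ 2) + 4 * π * K) / a ^ 2 := by
    have heq : ∫ y in (ball (0 : EuclideanSpace ℝ (Fin 3)) a)ᶜ, ‖v s y‖ ^ 2 * ((1 : ℝ)⁻¹ * Pb (‖y‖ ^ 2 / 1 ^ 2)) =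
        (a ^ 2)⁻¹ * ∫ y in (ball (0 : EuclideanSpace ℝ (Fin 3)) a)ᶜ, ‖v s y‖ ^ 2 * (a⁻¹ * Pb (‖y‖ ^ 2 / a ^ 2)) := by
      rw [← integral_const_mul]
      refine setIntegral_congr_fun measurableSet_ball.compl fun y hy => ?_
      have hy' : a * 1 ≤ ‖y‖ := by
        rw [mul_one]
        simpa [mem_ball, dist_zero_right] using hy
      show ‖v s y‖ ^ 2 * ((1 : ℝ)⁻¹ * Pb (‖y‖ ^ 2 / 1 ^ 2)) =
        (a ^ 2)⁻¹ * (‖v s y‖ ^ 2 * (a⁻¹ * Pb (‖y‖ ^ 2 / a ^ 2)))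
      rw [inv_mul_probe_eq_of_le hPbd hode hP0 hPbpos ha one_pos hy', mul_one]
      ring
    rw [heq, div_eq_inv_mul]
    refine mul_le_mul_of_nonneg_left ?_ (by positivity)
    exact (setIntegral_le_integral hia (Eventually.of_forall fun y =>
      mul_nonneg (sq_nonneg _) (mul_nonneg (inv_pos.2 ha0).le (hPbnn _)))).trans hFa
  rw [← hin]
  linarith [hsplit, hF1, hout]

/-! ### Type I of the zooms -/

/-- **Type I for the ball energies of the zooms**: for `cρ ≤ 1/2` and `T + c²s ∈ (0, T)`,
`∫_{B_ρ(z)} |v^c(s)|² ≤ 2 M_F ρ`. [folklore] -/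
theorem setIntegral_ball_zoom_le {T : ℝ}
    {u : ℝ → EuclideanSpace ℝ (Fin 3) → EuclideanSpace ℝ (Fin 3)}
    {p : ℝ → EuclideanSpace ℝ (Fin 3) → ℝ}
    (hsol : IsClassicalNSSolutionOn (Ico 0 T) 1 0 u p) (hLH : IsLerayHopfOn T 1 0 (u 0) u)
    {K : ℝ} (hK : 0 ≤ K)
    (hone : (∀ t ∈ Ioo 0 T, ∀ x, ‖u t x‖ ^ 2 / 2 + normalisedPressure (u t) x ≤ K) ∨
      (∀ t ∈ Ioo 0 T, ∀ x, -K ≤ normalisedPressure (u t) x))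
    (x₀ : EuclideanSpace ℝ (Fin 3)) {c ρ s : ℝ} (hc : 0 < c) (hρ : 0 < ρ) (hcρ : c * ρ ≤ 1 / 2)
    (z : EuclideanSpace ℝ (Fin 3)) (ht : T + c ^ 2 * s ∈ Ioo 0 T) :
    ∫ y in ball z ρ, ‖(c • stPull (c ^ 2) c T x₀ u) s y‖ ^ 2 ≤
      2 * ((∫ x, ‖u 0 x‖ ^ 2) + 4 * π * K) * ρ := by
  rw [setIntegral_ball_norm_sq_stZoom hc]
  have h := setIntegral_ball_norm_sq_le_uniform zero_le_one hsol hLH hK hone ht (x₀ + c • z)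
    (mul_pos hc hρ) hcρ
  calc c⁻¹ * ∫ x in ball (x₀ + c • z) (c * ρ), ‖u (T + c ^ 2 * s) x‖ ^ 2
      ≤ c⁻¹ * (2 * ((∫ x, ‖u 0 x‖ ^ 2) + 4 * π * K) * (c * ρ)) :=
        mul_le_mul_of_nonneg_left h (inv_pos.2 hc).le
    _ = 2 * ((∫ x, ‖u 0 x‖ ^ 2) + 4 * π * K) * ρ := by field_simp


/-! ### The zooms on a closed time window below the vertex -/

/-- The zoom `v^c` is continuous on `[s₁, s₂] × ℝ³` whenever `T + c²s₁ ≥ 0` and `s₂ < 0`. [folklore] -/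
theorem continuousOn_zoom_window {T : ℝ}
    {u : ℝ → EuclideanSpace ℝ (Fin 3) → EuclideanSpace ℝ (Fin 3)}
    {p : ℝ → EuclideanSpace ℝ (Fin 3) → ℝ} (hsol : IsClassicalNSSolutionOn (Ico 0 T) 1 0 u p)
    (x₀ : EuclideanSpace ℝ (Fin 3)) {c s₁ s₂ : ℝ} (hc : 0 < c) (hs₁T : 0 ≤ T + c ^ 2 * s₁)
    (hs₂ : s₂ < 0) :
    ContinuousOn (fun z : ℝ × EuclideanSpace ℝ (Fin 3) => (c • stPull (c ^ 2) c T x₀ u) z.1 z.2)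
      (Icc s₁ s₂ ×ˢ (univ : Set (EuclideanSpace ℝ (Fin 3)))) := by
  have hmaps : MapsTo (fun z : ℝ × EuclideanSpace ℝ (Fin 3) => (T + c ^ 2 * z.1, x₀ + c • z.2))
      (Icc s₁ s₂ ×ˢ (univ : Set (EuclideanSpace ℝ (Fin 3))))
      (Ico 0 T ×ˢ (univ : Set (EuclideanSpace ℝ (Fin 3)))) := by
    rintro ⟨s, y⟩ ⟨⟨h1, h2⟩, -⟩
    refine ⟨⟨?_, ?_⟩, mem_univ _⟩
    · show 0 ≤ T + c ^ 2 * s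
      nlinarith [mul_le_mul_of_nonneg_left h1 (pow_pos hc 2).le]
    · show T + c ^ 2 * s < T
      nlinarith [mul_neg_of_pos_of_neg (pow_pos hc 2) (h2.trans_lt hs₂)]
  have haff : Continuous fun z : ℝ × EuclideanSpace ℝ (Fin 3) => (T + c ^ 2 * z.1, x₀ + c • z.2) := by
    fun_prop
  exact ((hsol.smooth_velocity.continuousOn.comp haff.continuousOn hmaps).const_smul c).congr
    fun z _ => rfl

/-- Integrability of `|v^c|² wt` on a window `(s₁, s₂) × B(z, ρ)`, `s₂ < 0`, for a continuous
weight `wt`. [folklore] -/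
theorem integrableOn_norm_sq_zoom_mul_window {T : ℝ}
    {u : ℝ → EuclideanSpace ℝ (Fin 3) → EuclideanSpace ℝ (Fin 3)}
    {p : ℝ → EuclideanSpace ℝ (Fin 3) → ℝ} (hsol : IsClassicalNSSolutionOn (Ico 0 T) 1 0 u p)
    (x₀ : EuclideanSpace ℝ (Fin 3)) {c s₁ s₂ : ℝ} (hc : 0 < c) (hs₁T : 0 ≤ T + c ^ 2 * s₁)
    (hs₂ : s₂ < 0) (z : EuclideanSpace ℝ (Fin 3)) (ρ : ℝ)
    {wt : ℝ × EuclideanSpace ℝ (Fin 3) → ℝ} (hwt : Continuous wt) :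
    IntegrableOn (fun w : ℝ × EuclideanSpace ℝ (Fin 3) =>
        ‖(c • stPull (c ^ 2) c T x₀ u) w.1 w.2‖ ^ 2 * wt w) (Ioo s₁ s₂ ×ˢ ball z ρ) := by
  have hK : IsCompact (Icc s₁ s₂ ×ˢ closedBall z ρ) := isCompact_Icc.prod (isCompact_closedBall z ρ)
  have hcont : ContinuousOn (fun w : ℝ × EuclideanSpace ℝ (Fin 3) =>
      ‖(c • stPull (c ^ 2) c T x₀ u) w.1 w.2‖ ^ 2) (Icc s₁ s₂ ×ˢ closedBall z ρ) :=
    ((continuousOn_zoom_window hsol x₀ hc hs₁T hs₂).mono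
      (prod_mono subset_rfl (subset_univ (closedBall z ρ)))).norm.pow 2
  exact ((hcont.mul hwt.continuousOn).integrableOn_compact hK).mono_set
    (prod_mono Ioo_subset_Icc_self ball_subset_closedBall)

/-- The real measure of a window. [folklore] -/
theorem volume_real_Ioo {s₁ s₂ : ℝ} (h : s₁ ≤ s₂) : volume.real (Ioo s₁ s₂) = s₂ - s₁ :=
  Real.volume_real_Ioo_of_le h

/-! ### The two bounds integrated over a time window -/

/-- **Largeness of the zooms, integrated in time**: under the hypotheses of
`setIntegral_ball_probe_zoom_ge`, for `−θ² ≤ s₁ < s₂ < 0` with `T + c²s₁ > 0`: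
`(s₂ − s₁)(δ/2 − M_F/a²) ≤ ∫_{(s₁,s₂)×B_a} |v^c|² P̄(|y|²)`.
[cite: SereginSverak2002, §4; reconstruction] -/
theorem setIntegral_window_probe_zoom_ge (hP : ContDiff ℝ ∞ P) (hPb : ContDiff ℝ ∞ Pb)
    (hode : ∀ σ, Pb σ + 2 / 3 * σ * deriv Pb σ = P σ) (hP0 : ∀ σ, 1 ≤ σ → P σ = 0)
    (hPnn : ∀ σ, 0 ≤ P σ) (hPle : ∀ σ, P σ ≤ Pb σ) (hPble : ∀ σ, Pb σ ≤ 1)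
    (hPbpos : ∀ σ, 0 < Pb σ) (hPb' : ∀ σ, deriv Pb σ ≤ 0)
    {T : ℝ} {u : ℝ → EuclideanSpace ℝ (Fin 3) → EuclideanSpace ℝ (Fin 3)}
    {p : ℝ → EuclideanSpace ℝ (Fin 3) → ℝ}
    (hsol : IsClassicalNSSolutionOn (Ico 0 T) 1 0 u p) (hLH : IsLerayHopfOn T 1 0 (u 0) u)
    {K : ℝ} (hK : 0 ≤ K)
    (hone : (∀ t ∈ Ioo 0 T, ∀ x, ‖u t x‖ ^ 2 / 2 + normalisedPressure (u t) x ≤ K) ∨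
      (∀ t ∈ Ioo 0 T, ∀ x, -K ≤ normalisedPressure (u t) x))
    (x₀ : EuclideanSpace ℝ (Fin 3)) {δ θ r₀ : ℝ}
    (hlarge : ∀ r ∈ Ioc 0 r₀, ∀ t ∈ Ioo (T - θ ^ 2 * r ^ 2) T,
      δ / 2 ≤ ∫ x, ‖u t x‖ ^ 2 * (r⁻¹ * Pb (‖x - x₀‖ ^ 2 / r ^ 2)))
    {c a : ℝ} (hc : 0 < c) (hcr₀ : c ≤ r₀) (ha : 1 ≤ a) (hac : a * c ≤ 1)
    {s₁ s₂ : ℝ} (hθs₁ : -θ ^ 2 ≤ s₁) (h12 : s₁ < s₂) (hs₂ : s₂ < 0) (hs₁T : 0 < T + c ^ 2 * s₁) :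
    (s₂ - s₁) * (δ / 2 - ((∫ x, ‖u 0 x‖ ^ 2) + 4 * π * K) / a ^ 2) ≤
      ∫ w in Ioo s₁ s₂ ×ˢ ball (0 : EuclideanSpace ℝ (Fin 3)) a,
        ‖(c • stPull (c ^ 2) c T x₀ u) w.1 w.2‖ ^ 2 * Pb (‖w.2‖ ^ 2) := by
  set F : ℝ × EuclideanSpace ℝ (Fin 3) → ℝ :=
    fun w => ‖(c • stPull (c ^ 2) c T x₀ u) w.1 w.2‖ ^ 2 * Pb (‖w.2‖ ^ 2) with hF
  have hwt : Continuous fun w : ℝ × EuclideanSpace ℝ (Fin 3) => Pb (‖w.2‖ ^ 2) :=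
    hPb.continuous.comp ((continuous_snd.norm).pow 2)
  have hint : IntegrableOn F (Ioo s₁ s₂ ×ˢ ball (0 : EuclideanSpace ℝ (Fin 3)) a) :=
    integrableOn_norm_sq_zoom_mul_window hsol x₀ hc hs₁T.le hs₂ 0 a hwt
  have hint' : Integrable F ((volume.restrict (Ioo s₁ s₂)).prod
      (volume.restrict (ball (0 : EuclideanSpace ℝ (Fin 3)) a))) := by
    rw [Measure.prod_restrict, ← Measure.volume_eq_prod]; exact hint
  have hfub : ∫ w in Ioo s₁ s₂ ×ˢ ball (0 : EuclideanSpace ℝ (Fin 3)) a, F w =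
      ∫ s in Ioo s₁ s₂, ∫ y in ball (0 : EuclideanSpace ℝ (Fin 3)) a, F (s, y) := by
    rw [Measure.volume_eq_prod, setIntegral_prod F (by rw [← Measure.volume_eq_prod]; exact hint)]
  rw [hfub]
  have hslice : ∀ s ∈ Ioo s₁ s₂, δ / 2 - ((∫ x, ‖u 0 x‖ ^ 2) + 4 * π * K) / a ^ 2 ≤
      ∫ y in ball (0 : EuclideanSpace ℝ (Fin 3)) a, F (s, y) := by
    intro s hs
    have hsT : 0 < T + c ^ 2 * s := by nlinarith [mul_le_mul_of_nonneg_left hs.1.le (pow_pos hc 2).le]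
    exact setIntegral_ball_probe_zoom_ge hP hPb hode hP0 hPnn hPle hPble hPbpos hPb' hsol hLH hK hone
      x₀ hlarge hc hcr₀ ha hac ⟨by linarith [hs.1], hs.2.trans hs₂⟩ hsT
  have hge := setIntegral_ge_of_const_le (μ := volume) measurableSet_Ioo
    (by exact measure_Ioo_lt_top.ne) hslice hint'.integral_prod_left
  rw [volume_real_Ioo h12.le, smul_eq_mul] at hge
  exact hge

/-- **Type I of the zooms, integrated in time**: for `cρ ≤ 1/2`, `s₁ < s₂ < 0` with `T + c²s₁ > 0`
and any centre `z`: `∫_{(s₁,s₂)×B_ρ(z)} |v^c|² ≤ (s₂ − s₁) · 2 M_F ρ`. [folklore] -/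
theorem setIntegral_window_ball_zoom_le {T : ℝ}
    {u : ℝ → EuclideanSpace ℝ (Fin 3) → EuclideanSpace ℝ (Fin 3)}
    {p : ℝ → EuclideanSpace ℝ (Fin 3) → ℝ}
    (hsol : IsClassicalNSSolutionOn (Ico 0 T) 1 0 u p) (hLH : IsLerayHopfOn T 1 0 (u 0) u)
    {K : ℝ} (hK : 0 ≤ K)
    (hone : (∀ t ∈ Ioo 0 T, ∀ x, ‖u t x‖ ^ 2 / 2 + normalisedPressure (u t) x ≤ K) ∨
      (∀ t ∈ Ioo 0 T, ∀ x, -K ≤ normalisedPressure (u t) x))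
    (x₀ : EuclideanSpace ℝ (Fin 3)) {c ρ : ℝ} (hc : 0 < c) (hρ : 0 < ρ) (hcρ : c * ρ ≤ 1 / 2)
    (z : EuclideanSpace ℝ (Fin 3)) {s₁ s₂ : ℝ} (h12 : s₁ < s₂) (hs₂ : s₂ < 0)
    (hs₁T : 0 < T + c ^ 2 * s₁) :
    ∫ w in Ioo s₁ s₂ ×ˢ ball z ρ, ‖(c • stPull (c ^ 2) c T x₀ u) w.1 w.2‖ ^ 2 ≤
      (s₂ - s₁) * (2 * ((∫ x, ‖u 0 x‖ ^ 2) + 4 * π * K) * ρ) := by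
  set F : ℝ × EuclideanSpace ℝ (Fin 3) → ℝ :=
    fun w => ‖(c • stPull (c ^ 2) c T x₀ u) w.1 w.2‖ ^ 2 with hF
  have hint : IntegrableOn F (Ioo s₁ s₂ ×ˢ ball z ρ) := by
    have := integrableOn_norm_sq_zoom_mul_window hsol x₀ hc hs₁T.le hs₂ z ρ continuous_const
      (wt := fun _ => (1 : ℝ))
    simpa only [hF, mul_one] using this
  have hint' : Integrable F ((volume.restrict (Ioo s₁ s₂)).prod (volume.restrict (ball z ρ))) := by
    rw [Measure.prod_restrict, ← Measure.volume_eq_prod]; exact hint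
  have hfub : ∫ w in Ioo s₁ s₂ ×ˢ ball z ρ, F w = ∫ s in Ioo s₁ s₂, ∫ y in ball z ρ, F (s, y) := by
    rw [Measure.volume_eq_prod, setIntegral_prod F (by rw [← Measure.volume_eq_prod]; exact hint)]
  rw [hfub]
  have hslice : ∀ s ∈ Ioo s₁ s₂, ∫ y in ball z ρ, F (s, y) ≤
      2 * ((∫ x, ‖u 0 x‖ ^ 2) + 4 * π * K) * ρ := by
    intro s hs
    have hsT : T + c ^ 2 * s ∈ Ioo 0 T := by
      refine ⟨by nlinarith [mul_le_mul_of_nonneg_left hs.1.le (pow_pos hc 2).le], ?_⟩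
      nlinarith [mul_neg_of_pos_of_neg (pow_pos hc 2) (hs.2.trans hs₂)]
    exact setIntegral_ball_zoom_le hsol hLH hK hone x₀ hc hρ hcρ z hsT
  calc ∫ s in Ioo s₁ s₂, ∫ y in ball z ρ, F (s, y)
      ≤ ∫ s in Ioo s₁ s₂, 2 * ((∫ x, ‖u 0 x‖ ^ 2) + 4 * π * K) * ρ :=
        setIntegral_mono_on hint'.integral_prod_left
          (integrableOn_const (C := 2 * ((∫ x, ‖u 0 x‖ ^ 2) + 4 * π * K) * ρ)
            (by exact measure_Ioo_lt_top.ne)) measurableSet_Ioo hslice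
    _ = (s₂ - s₁) * (2 * ((∫ x, ‖u 0 x‖ ^ 2) + 4 * π * K) * ρ) := by
        rw [setIntegral_const, volume_real_Ioo h12.le, smul_eq_mul]

/-! ### Weighted `L²` masses under `L²` convergence -/

section Limit

variable {X : Type*} [MeasurableSpace X] {μ : Measure X}
  {F : Type*} [NormedAddCommGroup F] [NormedSpace ℝ F]

omit [NormedSpace ℝ F] in
/-- `‖h‖_{L²}` as a power of `∫ ‖h‖²`. [folklore] -/
theorem eLpNorm_two_eq_rpow (h : X → F) :
    eLpNorm h 2 μ = (∫⁻ x, ‖h x‖ₑ ^ (2 : ℝ) ∂μ) ^ (1 / 2 : ℝ) := by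
  rw [eLpNorm_eq_lintegral_rpow_enorm_toReal two_ne_zero ENNReal.ofNat_ne_top]
  norm_num

/-- `∫⁻ ‖√wt • h‖ₑ² = ofReal (∫ wt ‖h‖²)` for `0 ≤ wt` and `wt ‖h‖²` integrable. [folklore] -/
theorem lintegral_enorm_sqrt_smul_rpow_two {h : X → F} {wt : X → ℝ} (hwt0 : ∀ x, 0 ≤ wt x)
    (hint : Integrable (fun x => wt x * ‖h x‖ ^ 2) μ) :
    ∫⁻ x, ‖Real.sqrt (wt x) • h x‖ₑ ^ (2 : ℝ) ∂μ = ENNReal.ofReal (∫ x, wt x * ‖h x‖ ^ 2 ∂μ) := by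
  rw [ofReal_integral_eq_lintegral_ofReal hint
    (Eventually.of_forall fun x => mul_nonneg (hwt0 x) (sq_nonneg _))]
  refine lintegral_congr fun x => ?_
  rw [← ofReal_norm, ENNReal.ofReal_rpow_of_nonneg (norm_nonneg _) (by norm_num), norm_smul,
    Real.norm_eq_abs, abs_of_nonneg (Real.sqrt_nonneg _), Real.rpow_two, mul_pow,
    Real.sq_sqrt (hwt0 x)]

/-- **Lower bounds on weighted `L²` masses pass to `L²` limits.** If `f_j → g` in `L²(μ)`,
`0 ≤ wt ≤ 1` is measurable, and `L ≤ ∫ wt |f_j|²` for all large `j`, then `L ≤ ∫ wt |g|²`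
(Minkowski in `L²`). [folklore] -/
theorem le_integral_mul_norm_sq_of_tendsto {f : ℕ → X → F} {g : X → F}
    (hf : ∀ᶠ j in atTop, MemLp (f j) 2 μ) (hg : MemLp g 2 μ)
    (hconv : Tendsto (fun j => eLpNorm (f j - g) 2 μ) atTop (𝓝 0))
    {wt : X → ℝ} (hwtm : Measurable wt) (hwt0 : ∀ x, 0 ≤ wt x) (hwt1 : ∀ x, wt x ≤ 1)
    {L : ℝ} (hL : ∀ᶠ j in atTop, L ≤ ∫ x, wt x * ‖f j x‖ ^ 2 ∂μ) :
    L ≤ ∫ x, wt x * ‖g x‖ ^ 2 ∂μ := by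
  -- integrability of the weighted squares
  have hwi : ∀ {h : X → F}, MemLp h 2 μ → Integrable (fun x => wt x * ‖h x‖ ^ 2) μ := by
    intro h hh
    have h2 : Integrable (fun x => ‖h x‖ ^ 2) μ := hh.integrable_norm_pow two_ne_zero
    refine h2.mono' ((hwtm.aestronglyMeasurable).mul h2.aestronglyMeasurable)
      (Eventually.of_forall fun x => ?_)
    rw [Real.norm_eq_abs, abs_mul, abs_of_nonneg (hwt0 x), abs_of_nonneg (sq_nonneg _)]
    exact mul_le_of_le_one_left (sq_nonneg _) (hwt1 x)
  have hI0 : 0 ≤ ∫ x, wt x * ‖g x‖ ^ 2 ∂μ := integral_nonneg fun x => mul_nonneg (hwt0 x) (sq_nonneg _)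
  -- the weighted functions
  have hsm : ∀ {h : X → F}, AEStronglyMeasurable h μ →
      AEStronglyMeasurable (fun x => Real.sqrt (wt x) • h x) μ := fun hh =>
    (hwtm.sqrt.aestronglyMeasurable).smul hh
  have hψ : eLpNorm (fun x => Real.sqrt (wt x) • g x) 2 μ =
      (ENNReal.ofReal (∫ x, wt x * ‖g x‖ ^ 2 ∂μ)) ^ (1 / 2 : ℝ) := by
    rw [eLpNorm_two_eq_rpow, lintegral_enorm_sqrt_smul_rpow_two hwt0 (hwi hg)]
  -- `(ofReal L)^{1/2} ≤ ‖√wt g‖₂ + ‖f_j - g‖₂` for large `j`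
  have hev : ∀ᶠ j in atTop, (ENNReal.ofReal L) ^ (1 / 2 : ℝ) ≤
      eLpNorm (fun x => Real.sqrt (wt x) • g x) 2 μ + eLpNorm (f j - g) 2 μ := by
    filter_upwards [hL, hf] with j hj hfj
    have hφ : eLpNorm (fun x => Real.sqrt (wt x) • f j x) 2 μ =
        (ENNReal.ofReal (∫ x, wt x * ‖f j x‖ ^ 2 ∂μ)) ^ (1 / 2 : ℝ) := by
      rw [eLpNorm_two_eq_rpow, lintegral_enorm_sqrt_smul_rpow_two hwt0 (hwi hfj)]
    have h1 : (ENNReal.ofReal L) ^ (1 / 2 : ℝ) ≤ eLpNorm (fun x => Real.sqrt (wt x) • f j x) 2 μ := by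
      rw [hφ]
      exact ENNReal.rpow_le_rpow (ENNReal.ofReal_le_ofReal hj) (by norm_num)
    have h2 : eLpNorm (fun x => Real.sqrt (wt x) • f j x) 2 μ ≤
        eLpNorm (fun x => Real.sqrt (wt x) • g x) 2 μ +
          eLpNorm (fun x => Real.sqrt (wt x) • (f j x - g x)) 2 μ := by
      have hdec : (fun x => Real.sqrt (wt x) • f j x) =
          (fun x => Real.sqrt (wt x) • g x) + fun x => Real.sqrt (wt x) • (f j x - g x) := by
        funext x
        simp only [Pi.add_apply, smul_sub, add_sub_cancel]
      rw [hdec]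
      exact eLpNorm_add_le (hsm hg.aestronglyMeasurable)
        (hsm (hfj.aestronglyMeasurable.sub hg.aestronglyMeasurable)) (by norm_num)
    have h3 : eLpNorm (fun x => Real.sqrt (wt x) • (f j x - g x)) 2 μ ≤ eLpNorm (f j - g) 2 μ := by
      refine eLpNorm_mono fun x => ?_
      rw [norm_smul, Real.norm_eq_abs, abs_of_nonneg (Real.sqrt_nonneg _)]
      calc Real.sqrt (wt x) * ‖f j x - g x‖ ≤ 1 * ‖f j x - g x‖ :=
            mul_le_mul_of_nonneg_right (Real.sqrt_le_one.mpr (hwt1 x)) (norm_nonneg _)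
        _ = ‖(f j - g) x‖ := by rw [one_mul, Pi.sub_apply]
    exact h1.trans (h2.trans (add_le_add le_rfl h3))
  have hlim : Tendsto (fun j => eLpNorm (fun x => Real.sqrt (wt x) • g x) 2 μ + eLpNorm (f j - g) 2 μ)
      atTop (𝓝 (eLpNorm (fun x => Real.sqrt (wt x) • g x) 2 μ + 0)) :=
    tendsto_const_nhds.add hconv
  rw [add_zero] at hlim
  have hle := ge_of_tendsto hlim hev
  rw [hψ, ENNReal.rpow_le_rpow_iff (by norm_num : (0 : ℝ) < 1 / 2)] at hle
  exact (ENNReal.ofReal_le_ofReal_iff hI0).1 hle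

/-- **Upper bounds on `L²` masses pass to `L²` limits.** If `f_j → g` in `L²(μ)` and
`∫ |f_j|² ≤ U` for all large `j`, then `∫ |g|² ≤ U`. [folklore] -/
theorem integral_norm_sq_le_of_tendsto {f : ℕ → X → F} {g : X → F}
    (hf : ∀ᶠ j in atTop, MemLp (f j) 2 μ) (hg : MemLp g 2 μ)
    (hconv : Tendsto (fun j => eLpNorm (f j - g) 2 μ) atTop (𝓝 0))
    {U : ℝ} (hU : ∀ᶠ j in atTop, ∫ x, ‖f j x‖ ^ 2 ∂μ ≤ U) :
    ∫ x, ‖g x‖ ^ 2 ∂μ ≤ U := by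
  have h2 : ∀ {h : X → F}, MemLp h 2 μ →
      eLpNorm h 2 μ = (ENNReal.ofReal (∫ x, ‖h x‖ ^ 2 ∂μ)) ^ (1 / 2 : ℝ) := by
    intro h hh
    have := lintegral_enorm_sqrt_smul_rpow_two (h := h) (wt := fun _ => (1 : ℝ)) (μ := μ)
      (fun _ => zero_le_one) (by simpa only [one_mul] using hh.integrable_norm_pow two_ne_zero)
    simp only [Real.sqrt_one, one_smul, one_mul] at this
    rw [eLpNorm_two_eq_rpow, this]
  obtain ⟨j₀, hj₀⟩ := hU.exists
  have hU0 : 0 ≤ U := le_trans (integral_nonneg fun x => by positivity) hj₀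
  have hev : ∀ᶠ j in atTop, eLpNorm g 2 μ ≤ (ENNReal.ofReal U) ^ (1 / 2 : ℝ) + eLpNorm (f j - g) 2 μ := by
    filter_upwards [hU, hf] with j hj hfj
    have h1 : eLpNorm g 2 μ ≤ eLpNorm (f j) 2 μ + eLpNorm (g - f j) 2 μ := by
      have hdec : g = f j + (g - f j) := by funext x; simp
      conv_lhs => rw [hdec]
      exact eLpNorm_add_le hfj.aestronglyMeasurable
        (hg.aestronglyMeasurable.sub hfj.aestronglyMeasurable) (by norm_num)
    rw [eLpNorm_sub_comm g (f j)] at h1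
    have h3 : eLpNorm (f j) 2 μ ≤ (ENNReal.ofReal U) ^ (1 / 2 : ℝ) := by
      rw [h2 hfj]
      exact ENNReal.rpow_le_rpow (ENNReal.ofReal_le_ofReal hj) (by norm_num)
    exact h1.trans (add_le_add h3 le_rfl)
  have hlim : Tendsto (fun j => (ENNReal.ofReal U) ^ (1 / 2 : ℝ) + eLpNorm (f j - g) 2 μ) atTop
      (𝓝 ((ENNReal.ofReal U) ^ (1 / 2 : ℝ) + 0)) :=
    tendsto_const_nhds.add hconv
  rw [add_zero] at hlim
  have hle := le_of_tendsto_of_tendsto tendsto_const_nhds hlim hev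
  rw [h2 hg, ENNReal.rpow_le_rpow_iff (by norm_num : (0 : ℝ) < 1 / 2)] at hle
  exact (ENNReal.ofReal_le_ofReal_iff hU0).1 hle

omit [NormedSpace ℝ F] in
/-- `L³` convergence on a set of finite measure gives `L²` convergence there. [folklore] -/
theorem tendsto_eLpNorm_two_of_three {S : Set X} (hS : μ S ≠ ⊤) {f : ℕ → X → F} {g : X → F}
    (hm : ∀ᶠ j in atTop, AEStronglyMeasurable (f j - g) (μ.restrict S))
    (hconv : Tendsto (fun j => eLpNorm (f j - g) 3 (μ.restrict S)) atTop (𝓝 0)) :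
    Tendsto (fun j => eLpNorm (f j - g) 2 (μ.restrict S)) atTop (𝓝 0) := by
  have hle : ∀ᶠ j in atTop, eLpNorm (f j - g) 2 (μ.restrict S) ≤
      eLpNorm (f j - g) 3 (μ.restrict S) *
        (μ.restrict S) univ ^ (1 / (2 : ℝ≥0∞).toReal - 1 / (3 : ℝ≥0∞).toReal) := by
    filter_upwards [hm] with j hj
    exact eLpNorm_le_eLpNorm_mul_rpow_measure_univ (by norm_num) hj
  have htop : (μ.restrict S) univ ^ (1 / (2 : ℝ≥0∞).toReal - 1 / (3 : ℝ≥0∞).toReal) ≠ ⊤ := by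
    rw [Measure.restrict_apply_univ]
    exact ENNReal.rpow_ne_top_of_nonneg (by norm_num) hS
  have hlim : Tendsto (fun j => eLpNorm (f j - g) 3 (μ.restrict S) *
      (μ.restrict S) univ ^ (1 / (2 : ℝ≥0∞).toReal - 1 / (3 : ℝ≥0∞).toReal)) atTop (𝓝 0) := by
    have := ENNReal.Tendsto.mul_const hconv (Or.inr htop)
    rwa [zero_mul] at this
  exact tendsto_of_tendsto_of_tendsto_of_le_of_le' tendsto_const_nhds hlim
    (Eventually.of_forall fun _ => zero_le) hle

end Limit

/-! ### The blow-up limit inherits both bounds -/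

/-- The zooms are in `L²` of every window `(s₁, s₂) × B(z, ρ)` with `T + c²s₁ ≥ 0`, `s₂ < 0`
(continuity on the compact closure). [folklore] -/
theorem memLp_two_zoom_window {T : ℝ}
    {u : ℝ → EuclideanSpace ℝ (Fin 3) → EuclideanSpace ℝ (Fin 3)}
    {p : ℝ → EuclideanSpace ℝ (Fin 3) → ℝ} (hsol : IsClassicalNSSolutionOn (Ico 0 T) 1 0 u p)
    (x₀ : EuclideanSpace ℝ (Fin 3)) {c s₁ s₂ : ℝ} (hc : 0 < c) (hs₁T : 0 ≤ T + c ^ 2 * s₁)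
    (hs₂ : s₂ < 0) (z : EuclideanSpace ℝ (Fin 3)) (ρ : ℝ) :
    MemLp (uncurry (c • stPull (c ^ 2) c T x₀ u)) 2
      (volume.restrict (Ioo s₁ s₂ ×ˢ ball z ρ)) := by
  have hK : IsCompact (Icc s₁ s₂ ×ˢ closedBall z ρ) := isCompact_Icc.prod (isCompact_closedBall z ρ)
  have hWK : Ioo s₁ s₂ ×ˢ ball z ρ ⊆ Icc s₁ s₂ ×ˢ closedBall z ρ :=
    prod_mono Ioo_subset_Icc_self ball_subset_closedBall
  have hcont : ContinuousOn (uncurry (c • stPull (c ^ 2) c T x₀ u)) (Icc s₁ s₂ ×ˢ closedBall z ρ) :=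
    (continuousOn_zoom_window hsol x₀ hc hs₁T hs₂).mono (prod_mono subset_rfl (subset_univ _))
  obtain ⟨B, hB⟩ := hK.exists_bound_of_continuousOn hcont
  have hfin : volume (Ioo s₁ s₂ ×ˢ ball z ρ) < ⊤ := (hK.measure_lt_top).trans_le' (measure_mono hWK)
  haveI : IsFiniteMeasure (volume.restrict (Ioo s₁ s₂ ×ˢ ball z ρ)) :=
    ⟨by rw [Measure.restrict_apply_univ]; exact hfin⟩
  refine MemLp.of_bound ((hcont.aestronglyMeasurable hK.measurableSet).mono_measure
    (Measure.restrict_mono hWK le_rfl)) B ?_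
  exact (ae_restrict_iff' (measurableSet_Ioo.prod measurableSet_ball)).2
    (Eventually.of_forall fun w hw => hB w (hWK hw))

/-- **The blow-up limit is large on final windows (integrated form).** In the setting of
`setIntegral_window_probe_zoom_ge` (`r₀ > 0`), let `R_j → 0` be positive scales with the zooms
`v^{R_j}` converging to `w` in `L³(Q(a'))`, `w ∈ L³(Q(a'))`, and let `(s₁, s₂) × B_a ⊆ Q(a')`
with `a ≥ 1`, `−θ² ≤ s₁ < s₂ < 0`. Then
`(s₂ − s₁)(δ/2 − M_F/a²) ≤ ∫_{(s₁,s₂)×B_a} |w|² P̄(|y|²)`.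
[cite: SereginSverak2002, §4; reconstruction] -/
theorem blowupLimit_window_probe_ge (hP : ContDiff ℝ ∞ P) (hPb : ContDiff ℝ ∞ Pb)
    (hode : ∀ σ, Pb σ + 2 / 3 * σ * deriv Pb σ = P σ) (hP0 : ∀ σ, 1 ≤ σ → P σ = 0)
    (hPnn : ∀ σ, 0 ≤ P σ) (hPle : ∀ σ, P σ ≤ Pb σ) (hPble : ∀ σ, Pb σ ≤ 1)
    (hPbpos : ∀ σ, 0 < Pb σ) (hPb' : ∀ σ, deriv Pb σ ≤ 0)
    {T : ℝ} (hT : 0 < T) {u : ℝ → EuclideanSpace ℝ (Fin 3) → EuclideanSpace ℝ (Fin 3)}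
    {p : ℝ → EuclideanSpace ℝ (Fin 3) → ℝ}
    (hsol : IsClassicalNSSolutionOn (Ico 0 T) 1 0 u p) (hLH : IsLerayHopfOn T 1 0 (u 0) u)
    {K : ℝ} (hK : 0 ≤ K)
    (hone : (∀ t ∈ Ioo 0 T, ∀ x, ‖u t x‖ ^ 2 / 2 + normalisedPressure (u t) x ≤ K) ∨
      (∀ t ∈ Ioo 0 T, ∀ x, -K ≤ normalisedPressure (u t) x))
    (x₀ : EuclideanSpace ℝ (Fin 3)) {δ θ r₀ : ℝ} (hr₀ : 0 < r₀)
    (hlarge : ∀ r ∈ Ioc 0 r₀, ∀ t ∈ Ioo (T - θ ^ 2 * r ^ 2) T,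
      δ / 2 ≤ ∫ x, ‖u t x‖ ^ 2 * (r⁻¹ * Pb (‖x - x₀‖ ^ 2 / r ^ 2)))
    {R : ℕ → ℝ} (hRpos : ∀ j, 0 < R j) (hR0 : Tendsto R atTop (𝓝 0))
    {w : ℝ → EuclideanSpace ℝ (Fin 3) → EuclideanSpace ℝ (Fin 3)} {a' : ℝ}
    (hw3 : MemLp (uncurry w) 3
      (volume.restrict (parabolicCylinder a' (0 : ℝ × EuclideanSpace ℝ (Fin 3)))))
    (hconv : Tendsto (fun j => eLpNorm
        (uncurry ((R j) • stPull ((R j) ^ 2) (R j) T x₀ u) - uncurry w) 3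
        (volume.restrict (parabolicCylinder a' (0 : ℝ × EuclideanSpace ℝ (Fin 3)))))
      atTop (𝓝 0))
    {a s₁ s₂ : ℝ} (ha : 1 ≤ a) (hθs₁ : -θ ^ 2 ≤ s₁) (h12 : s₁ < s₂) (hs₂ : s₂ < 0)
    (hS : Ioo s₁ s₂ ×ˢ ball (0 : EuclideanSpace ℝ (Fin 3)) a ⊆
      parabolicCylinder a' (0 : ℝ × EuclideanSpace ℝ (Fin 3))) :
    (s₂ - s₁) * (δ / 2 - ((∫ x, ‖u 0 x‖ ^ 2) + 4 * π * K) / a ^ 2) ≤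
      ∫ z in Ioo s₁ s₂ ×ˢ ball (0 : EuclideanSpace ℝ (Fin 3)) a, ‖w z.1 z.2‖ ^ 2 * Pb (‖z.2‖ ^ 2) := by
  have ha0 : 0 < a := by linarith
  have hPbnn : ∀ σ, 0 ≤ Pb σ := fun σ => (hPbpos σ).le
  set S : Set (ℝ × EuclideanSpace ℝ (Fin 3)) := Ioo s₁ s₂ ×ˢ ball (0 : EuclideanSpace ℝ (Fin 3)) a
    with hSdef
  have hKc : IsCompact (Icc s₁ s₂ ×ˢ closedBall (0 : EuclideanSpace ℝ (Fin 3)) a) :=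
    isCompact_Icc.prod (isCompact_closedBall _ _)
  have hSfin : volume S < ⊤ :=
    (hKc.measure_lt_top).trans_le' (measure_mono (prod_mono Ioo_subset_Icc_self ball_subset_closedBall))
  haveI : IsFiniteMeasure (volume.restrict S) := ⟨by rw [Measure.restrict_apply_univ]; exact hSfin⟩
  have hg : MemLp (uncurry w) 2 (volume.restrict S) :=
    (hw3.mono_measure (Measure.restrict_mono hS le_rfl)).mono_exponent (by norm_num)
  -- eventually the scales are small
  have hev : ∀ᶠ j in atTop, R j ≤ r₀ ∧ a * R j ≤ 1 ∧ 0 < T + R j ^ 2 * s₁ := by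
    have hε : 0 < min (min r₀ (1 / a)) (Real.sqrt (T / (θ ^ 2 + 1))) :=
      lt_min (lt_min hr₀ (by positivity)) (Real.sqrt_pos.2 (by positivity))
    filter_upwards [hR0.eventually_lt_const hε] with j hj
    have hj1 : R j < r₀ := hj.trans_le ((min_le_left _ _).trans (min_le_left _ _))
    have hj2 : R j < 1 / a := hj.trans_le ((min_le_left _ _).trans (min_le_right _ _))
    have hj3 : R j < Real.sqrt (T / (θ ^ 2 + 1)) := hj.trans_le (min_le_right _ _)
    refine ⟨hj1.le, ?_, ?_⟩
    · rw [lt_div_iff₀ ha0] at hj2; linarith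
    · have h1 : R j ^ 2 < T / (θ ^ 2 + 1) := by
        calc R j ^ 2 < Real.sqrt (T / (θ ^ 2 + 1)) ^ 2 :=
              pow_lt_pow_left₀ hj3 (hRpos j).le two_ne_zero
          _ = T / (θ ^ 2 + 1) := Real.sq_sqrt (by positivity)
      rw [lt_div_iff₀ (by positivity)] at h1
      nlinarith [mul_le_mul_of_nonneg_left hθs₁ (sq_nonneg (R j)), sq_nonneg (R j), sq_nonneg θ]
  -- the zooms are in `L²(S)` and satisfy the lower bound, eventually
  have hf : ∀ᶠ j in atTop, MemLp (uncurry ((R j) • stPull ((R j) ^ 2) (R j) T x₀ u)) 2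
      (volume.restrict S) := by
    filter_upwards [hev] with j hj
    exact memLp_two_zoom_window hsol x₀ (hRpos j) hj.2.2.le hs₂ 0 a
  have hL : ∀ᶠ j in atTop, (s₂ - s₁) * (δ / 2 - ((∫ x, ‖u 0 x‖ ^ 2) + 4 * π * K) / a ^ 2) ≤
      ∫ z, Pb (‖z.2‖ ^ 2) * ‖uncurry ((R j) • stPull ((R j) ^ 2) (R j) T x₀ u) z‖ ^ 2
        ∂(volume.restrict S) := by
    filter_upwards [hev] with j hj
    have h := setIntegral_window_probe_zoom_ge hP hPb hode hP0 hPnn hPle hPble hPbpos hPb' hsol hLH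
      hK hone x₀ hlarge (hRpos j) hj.1 ha hj.2.1 hθs₁ h12 hs₂ hj.2.2
    refine h.trans (le_of_eq (integral_congr_ae (Eventually.of_forall fun z => ?_)))
    show ‖((R j) • stPull ((R j) ^ 2) (R j) T x₀ u) z.1 z.2‖ ^ 2 * Pb (‖z.2‖ ^ 2) = _
    rw [mul_comm]; rfl
  -- `L²(S)` convergence from `L³(Q(a'))` convergence
  have hconv2 : Tendsto (fun j => eLpNorm
      (uncurry ((R j) • stPull ((R j) ^ 2) (R j) T x₀ u) - uncurry w) 2 (volume.restrict S))
      atTop (𝓝 0) := by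
    refine tendsto_eLpNorm_two_of_three hSfin.ne ?_ ?_
    · filter_upwards [hf] with j hj
      exact hj.aestronglyMeasurable.sub hg.aestronglyMeasurable
    · refine tendsto_of_tendsto_of_tendsto_of_le_of_le tendsto_const_nhds hconv
        (fun _ => zero_le) fun j => eLpNorm_mono_measure _ (Measure.restrict_mono hS le_rfl)
  -- pass to the limit
  have hwtm : Measurable fun z : ℝ × EuclideanSpace ℝ (Fin 3) => Pb (‖z.2‖ ^ 2) :=
    (hPb.continuous.comp ((continuous_snd.norm).pow 2)).measurable
  have key := le_integral_mul_norm_sq_of_tendsto hf hg hconv2 hwtm (fun z => hPbnn _)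
    (fun z => hPble _) hL
  refine key.trans (le_of_eq (integral_congr_ae (Eventually.of_forall fun z => ?_)))
  show Pb (‖z.2‖ ^ 2) * ‖uncurry w z‖ ^ 2 = ‖w z.1 z.2‖ ^ 2 * Pb (‖z.2‖ ^ 2)
  rw [mul_comm]; rfl

/-- **The blow-up limit is Type I (integrated form).** With scales `R_j → 0` and the `L³(Q(a'))`
limit `w` as above, for every ball `B_ρ(z)` and window `(s₁, s₂) × B_ρ(z) ⊆ Q(a')` with
`s₁ < s₂ < 0`: `∫_{(s₁,s₂)×B_ρ(z)} |w|² ≤ (s₂ − s₁) · 2M_F ρ`, `M_F = ‖u(0)‖₂² + 4πK`. [folklore] -/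
theorem blowupLimit_window_ball_le {T : ℝ} (hT : 0 < T)
    {u : ℝ → EuclideanSpace ℝ (Fin 3) → EuclideanSpace ℝ (Fin 3)}
    {p : ℝ → EuclideanSpace ℝ (Fin 3) → ℝ}
    (hsol : IsClassicalNSSolutionOn (Ico 0 T) 1 0 u p) (hLH : IsLerayHopfOn T 1 0 (u 0) u)
    {K : ℝ} (hK : 0 ≤ K)
    (hone : (∀ t ∈ Ioo 0 T, ∀ x, ‖u t x‖ ^ 2 / 2 + normalisedPressure (u t) x ≤ K) ∨
      (∀ t ∈ Ioo 0 T, ∀ x, -K ≤ normalisedPressure (u t) x))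
    (x₀ : EuclideanSpace ℝ (Fin 3))
    {R : ℕ → ℝ} (hRpos : ∀ j, 0 < R j) (hR0 : Tendsto R atTop (𝓝 0))
    {w : ℝ → EuclideanSpace ℝ (Fin 3) → EuclideanSpace ℝ (Fin 3)} {a' : ℝ}
    (hw3 : MemLp (uncurry w) 3
      (volume.restrict (parabolicCylinder a' (0 : ℝ × EuclideanSpace ℝ (Fin 3)))))
    (hconv : Tendsto (fun j => eLpNorm
        (uncurry ((R j) • stPull ((R j) ^ 2) (R j) T x₀ u) - uncurry w) 3
        (volume.restrict (parabolicCylinder a' (0 : ℝ × EuclideanSpace ℝ (Fin 3)))))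
      atTop (𝓝 0))
    {ρ s₁ s₂ : ℝ} (hρ : 0 < ρ) (z : EuclideanSpace ℝ (Fin 3)) (h12 : s₁ < s₂) (hs₂ : s₂ < 0)
    (hS : Ioo s₁ s₂ ×ˢ ball z ρ ⊆ parabolicCylinder a' (0 : ℝ × EuclideanSpace ℝ (Fin 3))) :
    ∫ v in Ioo s₁ s₂ ×ˢ ball z ρ, ‖w v.1 v.2‖ ^ 2 ≤
      (s₂ - s₁) * (2 * ((∫ x, ‖u 0 x‖ ^ 2) + 4 * π * K) * ρ) := by
  set S : Set (ℝ × EuclideanSpace ℝ (Fin 3)) := Ioo s₁ s₂ ×ˢ ball z ρ with hSdef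
  have hKc : IsCompact (Icc s₁ s₂ ×ˢ closedBall z ρ) := isCompact_Icc.prod (isCompact_closedBall _ _)
  have hSfin : volume S < ⊤ :=
    (hKc.measure_lt_top).trans_le' (measure_mono (prod_mono Ioo_subset_Icc_self ball_subset_closedBall))
  haveI : IsFiniteMeasure (volume.restrict S) := ⟨by rw [Measure.restrict_apply_univ]; exact hSfin⟩
  have hg : MemLp (uncurry w) 2 (volume.restrict S) :=
    (hw3.mono_measure (Measure.restrict_mono hS le_rfl)).mono_exponent (by norm_num)
  have hev : ∀ᶠ j in atTop, R j * ρ ≤ 1 / 2 ∧ 0 < T + R j ^ 2 * s₁ := by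
    have hε : 0 < min (1 / (2 * ρ)) (Real.sqrt (T / (|s₁| + 1))) :=
      lt_min (by positivity) (Real.sqrt_pos.2 (by positivity))
    filter_upwards [hR0.eventually_lt_const hε] with j hj
    have hj1 : R j < 1 / (2 * ρ) := hj.trans_le (min_le_left _ _)
    have hj2 : R j < Real.sqrt (T / (|s₁| + 1)) := hj.trans_le (min_le_right _ _)
    refine ⟨?_, ?_⟩
    · rw [lt_div_iff₀ (by positivity)] at hj1; linarith
    · have h1 : R j ^ 2 < T / (|s₁| + 1) := by
        calc R j ^ 2 < Real.sqrt (T / (|s₁| + 1)) ^ 2 :=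
              pow_lt_pow_left₀ hj2 (hRpos j).le two_ne_zero
          _ = T / (|s₁| + 1) := Real.sq_sqrt (by positivity)
      rw [lt_div_iff₀ (by positivity)] at h1
      nlinarith [neg_abs_le s₁, sq_nonneg (R j), mul_le_mul_of_nonneg_left (neg_abs_le s₁) (sq_nonneg (R j))]
  have hf : ∀ᶠ j in atTop, MemLp (uncurry ((R j) • stPull ((R j) ^ 2) (R j) T x₀ u)) 2
      (volume.restrict S) := by
    filter_upwards [hev] with j hj
    exact memLp_two_zoom_window hsol x₀ (hRpos j) hj.2.le hs₂ z ρ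
  have hU : ∀ᶠ j in atTop, ∫ v, ‖uncurry ((R j) • stPull ((R j) ^ 2) (R j) T x₀ u) v‖ ^ 2
      ∂(volume.restrict S) ≤ (s₂ - s₁) * (2 * ((∫ x, ‖u 0 x‖ ^ 2) + 4 * π * K) * ρ) := by
    filter_upwards [hev] with j hj
    exact setIntegral_window_ball_zoom_le hsol hLH hK hone x₀ (hRpos j) hρ hj.1 z h12 hs₂ hj.2
  have hconv2 : Tendsto (fun j => eLpNorm
      (uncurry ((R j) • stPull ((R j) ^ 2) (R j) T x₀ u) - uncurry w) 2 (volume.restrict S))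
      atTop (𝓝 0) := by
    refine tendsto_eLpNorm_two_of_three hSfin.ne ?_ ?_
    · filter_upwards [hf] with j hj
      exact hj.aestronglyMeasurable.sub hg.aestronglyMeasurable
    · exact tendsto_of_tendsto_of_tendsto_of_le_of_le tendsto_const_nhds hconv
        (fun _ => zero_le) fun j => eLpNorm_mono_measure _ (Measure.restrict_mono hS le_rfl)
  exact integral_norm_sq_le_of_tendsto hf hg hconv2 hU

end SereginSverak2002

end Literature.Analysis.FluidPDE

end
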